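import Mathlib.Analysis.Complex.ExponentialBounds
import HarnessLib

/-!
# `log 2` to twenty decimal places

Topic: `Literature/Analysis/SpecialFunctions`. Mathlib stops at `Real.log_two_near_10`
(`|log 2 − 287209/414355| ≤ 10⁻¹⁰`, hence `log_two_gt_d9`/`log_two_lt_d9`). Certified numerics
over long products of primes (provefact `Literature.NumberTheory.LFunctions.robin_iff`, plan N1: a kernel-checked table of
`log p` for `p < 4¹¹` seeded by `log 2` alone, through `log p = log(p−1) + log(1 + 1/(p−1))`) need
`log 2` to about `10⁻¹⁵`; this file PROVES it to `4·10⁻²⁰` by Mathlib's own method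
(`Real.abs_log_sub_add_sum_range_le`: the Taylor polynomial of `−log(1−x)` at `x = 1/2` with
`66` terms, remainder `≤ 2⁻⁶⁶`).

* `Literature.Analysis.SpecialFunctions.Real.log_two_near_20` : `|log 2 − S₆₆| ≤ 2⁻⁶⁶`, `S₆₆ = ∑_{i<66} 2^{-(i+1)}/(i+1)`;
* `Literature.Real.log_two_gt_d20 : 0.69314718055994530940 < log 2`,
  `Literature.Real.log_two_lt_d20 : log 2 < 0.69314718055994530944` (true value `0.693147180559945309417…`).

## References

* Mathlib, `Mathlib/Analysis/Complex/ExponentialBounds.lean` (`Real.log_two_near_10`, the method).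
-/

namespace Literature.Analysis.SpecialFunctions.Real

open Finset

/-- `|log 2 − S₆₆| ≤ 2⁻⁶⁶` with `S₆₆` the `66`-term Taylor polynomial of `−log(1 − x)` at `1/2`,
written out as a rational number. [folklore] -/
theorem log_two_near_20 :
    |Real.log 2 - 3023365856228144500683756623755713982082508821 /
        4361794927573358792789214461006653544328069120| ≤ 1 / 2 ^ 66 := by
  have t : |(2⁻¹ : ℝ)| = 2⁻¹ := by rw [abs_of_pos]; norm_num
  have z := Real.abs_log_sub_add_sum_range_le (show |(2⁻¹ : ℝ)| < 1 by rw [t]; norm_num) 66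
  rw [t] at z
  norm_num1 at z
  rw [one_div (2 : ℝ), Real.log_inv, ← sub_eq_add_neg, _root_.abs_sub_comm] at z
  norm_num1
  exact z

/-- `log 2 > 0.69314718055994530940`. [folklore] -/
theorem log_two_gt_d20 : (0.69314718055994530940 : ℝ) < Real.log 2 :=
  lt_of_lt_of_le (by norm_num1) (sub_le_comm.1 (abs_sub_le_iff.1 log_two_near_20).2)

/-- `log 2 < 0.69314718055994530944`. [folklore] -/
theorem log_two_lt_d20 : Real.log 2 < 0.69314718055994530944 :=
  lt_of_le_of_lt (sub_le_iff_le_add.1 (abs_sub_le_iff.1 log_two_near_20).1) (by norm_num1)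

end Literature.Analysis.SpecialFunctions.Real
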